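import Literature.MathematicalPhysics.QuantumFieldTheory.Balaban1983to89.B9Eq324DeltaPrimeATower
import Literature.MathematicalPhysics.QuantumFieldTheory.Balaban1983to89.B9Eq3119DeltaPiCarrier

/-!
# `Balaban1983to89.B9Eq3119DeltaPiTower` — T. Bałaban, *Propagators for lattice gauge theories in a background field*, Commun. Math. Phys. **99**
# (1985) 389–434 [Balaban1985BackgroundPropagators] (3.118)–(3.119) p. 419, (3.122)–(3.126) p. 420, (3.146)–(3.147) p. 425, (3.153) p. 426, with
# (3.19)∕(3.15) p. 393 (the composite averagings) and [Balaban1985Variational] (103) p. 293, (110)–(111) p. 294: PRINT's GAUGE-INVARIANT EXTENSION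
# `Δ_π` AND PRINT's OPERATOR `G̃⁻¹ = Δ_π + DRD* + Q*aQ` (3.122) FOR THE `k`-TH-STEP (COMPOSITE-AVERAGING) LETTERS — `π_k(U) = 1 − D_U G′_k R_k(U) D*_U`,
# `Δ_{π,k}(U) = π_k(U)ᵗ Δ^η(U) π_k(U)`, `Δ̃_{a,k}(U) := π_k(U)† Δ^η(U) π_k(U) + D_U R_k(U) D*_U + Q_k(U)* a Q_k(U)`; the (3.124)-identities `Q_k G̃ D R_k = 0`,
# `R_k D* G̃ D R_k = R_k`, `R_k D* G̃ Q_k* = 0` and hence `Q_k 𝔊̃_k = 0`, `R_k D* 𝔊̃_k = 0` for ITS letters, modulo (3.115) ONLY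

statement-level skeleton of published theorems with citation tags; proofs where landed; nothing here is a claim about the Yang–Mills mass gap

CITATION HEADER (lean-in-tree rule).  Audit cell `pub-balaban`, sub-cell `t4`, BINDER row NE9; filed by the row OWNER lineage `b2b-balaban-t4-ne9-p1`
(gen 87; plan v7 «the Δ_π port», object file).  Sources READ by this lineage in the held texts: [Balaban1985BackgroundPropagators] pp. 418–421, 425–426
(`paper:balaban1985-cmp99-background-propagators`, journal page = PDF page + 388: p. 419 (3.118)–(3.119), p. 420 (3.121)–(3.126), p. 421 (3.128)–(3.130),
p. 425 (3.146)–(3.147), p. 426 (3.150)–(3.153), Thm 3.13); [Balaban1985Variational] pp. 285, 290, 293–294 (`paper:balaban1985-cmp102-variational-background`,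
journal page = PDF page + 276: (45)–(46), (79)–(80), p. 293 «𝔓 is an orthogonal projection … defined by the operator Δ₁ + D*RD + aQ*Q, onto … QA = 0,
RD*A′ = 0», p. 294 «G₁ an inverse operator to Δ₁ + DRD* + aQ*Q … In [5] we have proved that G₁𝔓* = 𝔊 … Q𝔊 = 0, RD*𝔊 = 0»).

THE PRINT (verbatim).  [B9] p. 419: *«We define a new quadratic form extending ⟨A, ΔA⟩ in a gauge invariant way to all configurations A … (A, Δ_πA) =
⟨A − DG′RD*A, Δ(A − DG′RD*A)⟩. (3.119) The quadratic form is invariant with respect to gauge transformations determined by λ ∈ N(Q′)»*; p. 420: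
*«We replace the operator Δ by Δ_π in (3.112) … G̃⁻¹ defined as G̃⁻¹ = Δ_π + DRD* + Q*aQ … HB = GQ*(QGQ*)⁻¹B. (3.126) … It differs from the operator
investigated in previous sections by the additional term Δ′_π, but we will prove that this term is a small perturbation of Δ_a»*; p. 421: *«Let us denote for
a moment the operator we have investigated in previous sections by G₀, i.e. G₀ = (Δ + DRD* + Q*aQ)⁻¹. From (3.120) we get G = G₀(I − Δ′_πG₀)⁻¹ (3.130)»*;
p. 425: *«Verifying the above properties we need to know only the identities (3.124) and RD*G₁DR = R»*.

WHY THIS FILE (cell context; DIAGNOSIS D-ne9p1-g87-1).  Generations 77–87 of this lineage built the `k`-level chart letters `G_k`, `H_{1,k}`, `𝔊_k` and their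
energy-currency estimates on `B9Eq326OperatorTower.laplaceAk` — print's `G₀`-slot of p. 421, the Hessian `Δ^η(U)` of (3.10) (`hessOp`) in the `Δ₁`-slot of
`B11Eq103H1Complex.laplaceALatticeK`.  Print's `H` of (3.126) ∕ [B11] (45), (103) and print's `𝔊` of (3.148)∕(3.153) ∕ [B11] (110)–(111) are the letters of the
OTHER operator `G̃⁻¹ = Δ_π + DRD* + Q*aQ` (3.122), whose `Δ₁`-slot is the GAUGE-INVARIANT EXTENSION `Δ_π` (3.119): only for it do the (3.124)-identities (hence
`Q𝔊 = 0`, `RD*𝔊 = 0`, `𝔓` the orthogonal projection ONTO `{QA = 0, RD*A = 0}`) hold at a general background — for the bare `Δ` the needed letter (g1)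
«`Δ(Dλ) = 0`, `λ ∈ N(Q′)`» fails off the flat point ((3.117): the current `J`).  NE9 leaf-01 typed the extension abstractly and at the ONE-STEP letters
(`B9Eq3119InvariantExtension`, `B9Eq3124GaugeModes`), NE9 leaf-05 the one-step carrier `B9Eq3119DeltaPiCarrier` (`piOfU`, `deltaPiOfU`, `GpOfU`); the
`k`-TH-STEP objects (composite averagings (3.15)∕(3.19), the letters every `…Tower…` file of the row uses) did not exist.  This file types them — the OBJECT
of the lineage's next programme («the Δ_π port»: (i) this file; (ii) `Δ′_{π,k} = Δ_{π,k} − Δ^η` FORM-SMALL in the energy currency from (3.120) + (3.36)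
(`B9Eq3117Current.eq3120`, `B9Eq336CurrentBound`, to be bridged to the chain's letters); (iii) the strong coercivity of `Δ̃_{a,k}(U)` = that of `Δ_{a,k}(U)`
(`B9Eq3153FrakGkBoundDiagonal` §1) minus (ii); (iv) the whole energy-currency ball (`B9Eq3126EnergyBallTowerClosed`) transferred to the `Δ_π`-letters by the
lineage's ABSTRACT form-perturbation files (`B9Eq386GreenLipschitzEnergy` = (3.130) to first order in the energy norm, `B9Eq3126H1LipschitzEnergy`,
`B9Eq3153FrakGLipschitzEnergy`), so that O-NE9-1's identification «the chain's `cur U` letters = Bałaban's 𝐇_k» can be made for PRINT's operator).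

WHAT IS TYPED ∕ PROVED (definitions + sorry-free theorems; no `Prop` placeholder; no inequality of the paper asserted).
* §1 **`piOfUk`** — print's `π_k(U) := 1 − D_U G′ R_k(U) D*_U` at the `k`-th-step letters (`R_k(U)` = `B9Eq326OperatorTower.RofUk`, the projection onto
  `Δ_U N(Q′_k(U))`; the Green's function `G′` a LETTER `Gp`, inhabited in §3 by `B9Eq324DeltaPrimeATower.GpOfUk = (Δ′_{a′,k}(U))⁻¹`);
  **`piOfUk_gaugeMode`**: `π_k(U)(D_Uλ) = 0` for `Q′_k(U)λ = 0`, given (g5) `Q′_kλ = 0 → G′(Δ_Uλ) = λ` (`B9Eq3119InvariantExtension.printProjectionLattice_gaugeMode`).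
* §2 **`deltaPiOfUk`** — `Δ_{π,k}(U) := π_k(U)ᵗ Δ^η(U) π_k(U)` with the BILINEAR transpose (the verbatim twin of `B9Eq3119DeltaPiCarrier.deltaPiOfU`, the type of
  the (80)-current); `tpair_deltaPiOfUk` ((3.119) polarized), **`tpair_deltaPiOfUk_comm`** (symmetric for the bilinear trace pairing at a unitary background,
  `*`-trace), **`deltaPiOfUk_gaugeMode`**, **`deltaPiOfUk_GpOfUk_gaugeMode`** (kills `D_Uλ`, `λ ∈ N(Q′_k(U))`, with NO letter but the positivity of `Δ′_{a′,k}(U)`).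
* §3 **`laplaceAkPi`** — PRINT's OPERATOR (3.122) AT `n+1` LEVELS: `Δ̃_{a,k}(U) := laplaceALatticeK η⁻¹ R(U) R(U⁻¹) (π_k(U)† ∘ Δ^η(U) ∘ π_k(U)) R_k(U) Q_k(U) a`
  with `Gp := G′_k = GpOfUk` (the Hilbert-ADJOINT extension `π†Δπ` of `B9Eq3119InvariantExtension` in the `Δ₁`-slot — it is the operator whose inverse is
  print's `G̃`∕`G` of (3.122)∕(3.126)∕(3.146); at a unitary background it agrees with the bilinear `Δ_{π,k}` of §2, the one-step proof being NE9 leaf-05's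
  `B9Eq3119DeltaPiReality` — the `k`-level reality lemma is NOT ported here); **`laplaceAkPi_isSymmetric`** (unitary background, `*`-trace, the cell's norming);
  **`laplaceAkPi_gaugeMode_h124`** (`Q_k(U) G̃ D_U R_k(U) s = 0`), **`laplaceAkPi_gaugeMode_hRDR`** (`R_k D*_U G̃ D_U R_k s = R_k s`), **`laplaceAkPi_gaugeMode_h124'`**
  (`R_k D*_U G̃ Q_k† y = 0`) — the three (3.124)-identities for `G̃ = G1LatticeK hpos` at `Δ̃_{a,k}(U)`, from (g5) (DISCHARGED by `GpOfUk_gaugeMode`) and the ONE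
  displayed letter (g2) = (3.115) `Q′_k(U)λ = 0 → Q_k(U)(D_Uλ) = 0`; whence **`Q_frakGLatticeK_pi`**, **`RDstar_frakGLatticeK_pi`**: PRINT's `Q𝔊 = 0`, `RD*𝔊 = 0`
  ([B11] p. 294) for `𝔊̃_k(U) := frakGLatticeK hpos hQ` at `Δ̃_{a,k}(U)`, modulo (g2), `hpos`, `hQ` only.
* §4 **`laplaceAkPiHol`** — the same operator with the PAIR-TYPED (bilinear) `Δ_{π,k}(U)` of §2 in the slot (no variable conjugated: the slot for rows
  whose complex variable is the background — t4-ne9-idea-1's junction note J-Δπ-hol); **`laplaceAkPiHol_gaugeMode_h124`** ∕ **`_hRDR`**,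
  **`Q_frakGLatticeK_piHol`** from (g2) alone via `B9Eq3124GaugeModes` ((g1) = `deltaPiOfUk_GpOfUk_gaugeMode`); `RD*𝔊 = 0` for this slot needs the
  k-level reality∕symmetry lemma (vi) — NOT here.
HONEST SCOPE ∕ DECLARED READINGS.  [folklore] composition by name of NE9 leaf-01's ∕ leaf-05's one-step files at the `k`-level letters; (M1) the `Δ₁`-slot of §3 is
the ADJOINT extension (see §3's caveat); (M2) DISPLAYED, never asserted: (g2) = (3.115) for the composite averaging at these letters (print proves it,
`B9Eq3114Proof.eq3115` types it on the `ℤᵈ` carrier — the bridge to `QkW`∕`QprimeTowerW` is not in this file), the positivity `hpos` of `Δ̃_{a,k}(U)` (print: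
«Δ′_π is a small perturbation of Δ_a» p. 420 + Thm 3.11 — step (ii)∕(iii) of the port, NOT here), `Q_k(U)` onto (`QkW_surjective` in the per-level regime);
(M3) NOT HERE: any estimate ((3.120)'s smallness, (3.130)'s Neumann series, Thm 3.13), the (N)-reading, print's Gaussian-integral proofs (3.121)∕(3.125)∕(3.151).
NOT summit progress (cell pub-balaban: NE9 NOT PRINTED ∕ NOT PROVED; «NE9 ⇐ the named binders»; row WALLED ON A MODEL (O-NE9-1; #5 UNRULED); spine PROVED 0∕9;
rung (B)+1 finite T⁴ — NOT infinite volume, NOT mass gap, NOT BetaPertH, NOT Clay).  HONEST DEPENDENCY (cell line): continuum YM on T⁴ ⇐ BetaPertH ∧ nine spine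
estimates (0/9 proved); BetaPertH ⇐ (D1) ∧ (D4) ∧ CAP+tail; G-an2-4 gates asym, D1 and NE2/3/4.  NEW file; nothing modified.  Net new unproved facts: 0.
-/

noncomputable section

open scoped InnerProductSpace ComplexConjugate BigOperators

namespace Literature.MathematicalPhysics.QuantumFieldTheory.Balaban1983to89.B9Eq3119DeltaPiTower

open B4Sect5Torus (TSite)
open B9SectCLatticeCarrier (Bond)
open B11Eq103H1Complex (SiteL2K BondL2K covDerivL2K covDivL2K covLaplaceSiteK laplaceALatticeK RLatticeK G1LatticeK frakGLatticeK
  Q_frakGLatticeK RDstar_frakGLatticeK laplaceALatticeK_isSymmetric)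
open B9Eq310HessianOperator (adTransportW hessOp)
open B9Eq310HessianHermitian (adTransportW_adjoint hessOp_isSymmetric_of_trace)
open B9Eq315QTorus (perCfg cornerSite)
open B9Eq315QTower (towerP UlevOf)
open B9Eq326OperatorTower (QprimeTowerW QkW RofUk RofUk_isSymmetric)
open B7Prop1Explicit (U1 Wcx boxVec)
open B9Eq311TracePairing (tpair)
open B9Eq3119DeltaPiCarrier (deltaPi tpair_deltaPi tpair_deltaPi_comm deltaPi_apply_eq_zero tpair_hessOp_comm)
open B9Eq3119InvariantExtension (printProjectionLattice_gaugeMode invariantExtension_isSymmetric h124_of_invariantExtension hRDR_of_invariantExtension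
  h124'_of_invariantExtension)
open B9Eq324DeltaPrimeATower (laplacePrimeAk GpOfUk GpOfUk_gaugeMode)

variable {d : ℕ} (L : ℕ) [NeZero L] (m : Fin d → ℕ) [∀ i, NeZero (m i)] (n : ℕ)
  {𝔸 : Type*} [NormedRing 𝔸] [NormedAlgebra ℂ 𝔸] [CompleteSpace 𝔸] [NormOneClass 𝔸] [StarRing 𝔸] [StarModule ℂ 𝔸]
  {W : Type*} [NormedAddCommGroup W] [InnerProductSpace ℂ W] [FiniteDimensional ℂ W] (φ : W ≃ₗ[ℂ] 𝔸) {c₀ : ℝ} [Fact (0 < c₀)]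
  (τ : 𝔸 →ₗ[ℂ] ℂ) (η : ℝ) (U : Bond d (towerP L m (n + 1)) → 𝔸ˣ)
  (Gp : SiteL2K ℂ d (towerP L m (n + 1)) c₀ W →ₗ[ℂ] SiteL2K ℂ d (towerP L m (n + 1)) c₀ W)

/-! ## §1 Print's `π_k(U) = 1 − D_U G′ R_k(U) D*_U` at the `k`-th-step letters -/

/-- **Print's `π_k(U) := 1 − D_U G′ R_k(U) D*_U`** ([B9] p. 419 «the expression A − DG′RD*A») at the `k`-th-step letters: `D_U`∕`D*_U` = (3.3)∕(3.8) at the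
transporters of `U` and the scalar `η⁻¹`, `R_k(U)` = `B9Eq326OperatorTower.RofUk` (the projection (3.21) onto `Δ_U N(Q′_k(U))` for the COMPOSITE `Q′_k(U)`), the
Green's function `G′` a LETTER `Gp`. [cite: Balaban1985BackgroundPropagators, (3.119) p.419, (3.21) p.394, (3.19) p.393] -/
def piOfUk : BondL2K ℂ d (towerP L m (n + 1)) c₀ W →ₗ[ℂ] BondL2K ℂ d (towerP L m (n + 1)) c₀ W :=
  LinearMap.id - covDerivL2K ℂ c₀ ((η : ℂ))⁻¹ (adTransportW φ U) ∘ₗ Gp ∘ₗ RofUk L m n φ η U ∘ₗ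
    covDivL2K ℂ c₀ ((η : ℂ))⁻¹ (adTransportW φ fun b => (U b)⁻¹)

omit [StarRing 𝔸] [StarModule ℂ 𝔸] [NormOneClass 𝔸] in
/-- **`π_k(U)` KILLS THE GAUGE MODES `D_Uλ`, `λ ∈ N(Q′_k(U))`**, given (g5) `Q′_kλ = 0 → G′(Δ_Uλ) = λ` for the letter `G′`.
[cite: Balaban1985BackgroundPropagators, (3.119) p.419] -/
theorem piOfUk_gaugeMode (hGp : ∀ l : SiteL2K ℂ d (towerP L m (n + 1)) c₀ W, QprimeTowerW L m n φ U l = 0 →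
      Gp (covLaplaceSiteK ((η : ℂ))⁻¹ (adTransportW φ U) (adTransportW φ fun b => (U b)⁻¹) l) = l)
    {l : SiteL2K ℂ d (towerP L m (n + 1)) c₀ W} (hl : QprimeTowerW L m n φ U l = 0) :
    piOfUk L m n φ η U Gp (covDerivL2K ℂ c₀ ((η : ℂ))⁻¹ (adTransportW φ U) l) = 0 :=
  printProjectionLattice_gaugeMode Gp hGp hl

/-! ## §2 `Δ_{π,k}(U) := π_k(U)ᵗ Δ^η(U) π_k(U)` — the bilinear (3.119) at the `k`-th-step letters -/

/-- **`Δ_{π,k}(U) := π_k(U)ᵗ Δ^η(U) π_k(U)`** — (3.119) at the chain's Hessian `hessOp φ η U τ` with the BILINEAR transpose, `k` levels.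
[cite: Balaban1985BackgroundPropagators, (3.119) p.419, (3.10) p.392] -/
def deltaPiOfUk : BondL2K ℂ d (towerP L m (n + 1)) c₀ W →ₗ[ℂ] BondL2K ℂ d (towerP L m (n + 1)) c₀ W :=
  deltaPi φ (piOfUk L m n φ η U Gp) (hessOp φ η U τ)

omit [NormOneClass 𝔸] in
/-- **`(A, Δ_{π,k}(U) B) = (π_k(U)A, Δ^η(U) π_k(U)B)`** — print's definition (3.119), polarized. [cite: Balaban1985BackgroundPropagators, (3.119) p.419] -/
theorem tpair_deltaPiOfUk (hφ : ∀ X Y : 𝔸, ⟪φ.symm X, φ.symm Y⟫_ℂ = τ (star X * Y)) (A B : BondL2K ℂ d (towerP L m (n + 1)) c₀ W) :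
    tpair φ τ A (deltaPiOfUk L m n φ τ η U Gp B) =
      tpair φ τ (piOfUk L m n φ η U Gp A) (hessOp φ η U τ (piOfUk L m n φ η U Gp B)) :=
  tpair_deltaPi φ τ _ _ hφ A B

omit [NormOneClass 𝔸] in
/-- **`Δ_{π,k}(U)` IS SYMMETRIC FOR THE BILINEAR TRACE PAIRING** (unitary background, `*`-trace, the cell's norming) — whatever the letter `G′`.
[cite: Balaban1985BackgroundPropagators, (3.119) p.419] -/
theorem tpair_deltaPiOfUk_comm (hτ₂ : ∀ X Y : 𝔸, τ (X * Y) = τ (Y * X)) (hφ : ∀ X Y : 𝔸, ⟪φ.symm X, φ.symm Y⟫_ℂ = τ (star X * Y))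
    (hU : ∀ b, star (U b : 𝔸) = ((U b)⁻¹ : 𝔸ˣ)) (A B : BondL2K ℂ d (towerP L m (n + 1)) c₀ W) :
    tpair φ τ A (deltaPiOfUk L m n φ τ η U Gp B) = tpair φ τ B (deltaPiOfUk L m n φ τ η U Gp A) :=
  tpair_deltaPi_comm φ τ _ _ hφ (tpair_hessOp_comm φ τ hτ₂ hφ η hU) A B

omit [NormOneClass 𝔸] in
/-- **`Δ_{π,k}(U)(D_Uλ) = 0` for `λ ∈ N(Q′_k(U))`**, given (g5) for the letter `G′`. [cite: Balaban1985BackgroundPropagators, (3.119) p.419] -/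
theorem deltaPiOfUk_gaugeMode (hGp : ∀ l : SiteL2K ℂ d (towerP L m (n + 1)) c₀ W, QprimeTowerW L m n φ U l = 0 →
      Gp (covLaplaceSiteK ((η : ℂ))⁻¹ (adTransportW φ U) (adTransportW φ fun b => (U b)⁻¹) l) = l)
    {l : SiteL2K ℂ d (towerP L m (n + 1)) c₀ W} (hl : QprimeTowerW L m n φ U l = 0) :
    deltaPiOfUk L m n φ τ η U Gp (covDerivL2K ℂ c₀ ((η : ℂ))⁻¹ (adTransportW φ U) l) = 0 :=
  deltaPi_apply_eq_zero φ _ _ (piOfUk_gaugeMode L m n φ η U Gp hGp hl)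

variable {c₁ : ℝ} [Fact (0 < c₁)] (a' : ℝ)
  (hpos' : ∀ x : SiteL2K ℂ d (towerP L m (n + 1)) c₀ W, x ≠ 0 → 0 < RCLike.re ⟪x, laplacePrimeAk L m n φ η U a' (c₁ := c₁) x⟫_ℂ)

omit [NormOneClass 𝔸] in
/-- **`Δ_{π,k}(U)` AT `G′ := G′_k = (Δ′_{a′,k}(U))⁻¹` KILLS THE GAUGE MODES with no letter but the positivity of `Δ′_{a′,k}(U)`**
(`B9Eq324DeltaPrimeATower.GpOfUk_gaugeMode`). [cite: Balaban1985BackgroundPropagators, (3.119) p.419, (3.24)–(3.25) p.394] -/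
theorem deltaPiOfUk_GpOfUk_gaugeMode {l : SiteL2K ℂ d (towerP L m (n + 1)) c₀ W} (hl : QprimeTowerW L m n φ U l = 0) :
    deltaPiOfUk L m n φ τ η U (GpOfUk L m n φ η U a' hpos') (covDerivL2K ℂ c₀ ((η : ℂ))⁻¹ (adTransportW φ U) l) = 0 :=
  deltaPiOfUk_gaugeMode L m n φ τ η U _ (fun l hl => GpOfUk_gaugeMode L m n φ η U a' hpos' l hl) hl

/-! ## §3 Print's operator (3.122) `Δ̃_{a,k}(U) = π†Δ^ηπ + D_U R_k D*_U + Q_k* a Q_k` at `n+1` levels and its (3.124)-identities -/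

variable (hL : 1 ≤ L) (αU : ℕ → ℝ) (hα1 : ∀ j, αU j ≤ 1 / 64)
  (hU1 : ∀ (j : ℕ) (x : B7Prop1Explicit.Site d) (κ : Fin d), perCfg (towerP L m (j + 1)) (UlevOf L m (n + 1) U j) x κ ∈ U1 𝔸)
  (hreg : ∀ (j : ℕ) (y : TSite d (towerP L m j)) (κ : Fin d) (r : Fin d → Fin L),
    ‖((Wcx L (perCfg (towerP L m (j + 1)) (UlevOf L m (n + 1) U j)) (cornerSite L y) κ (boxVec L r) : 𝔸ˣ) : 𝔸) - 1‖ ≤ αU j)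

/-- **PRINT's OPERATOR (3.122) AT `n+1` LEVELS**: `Δ̃_{a,k}(U) := laplaceALatticeK η⁻¹ R(U) R(U⁻¹) (π_k(U)† ∘ Δ^η(U) ∘ π_k(U)) R_k(U) Q_k(U) a` with
`G′ := G′_k = (Δ′_{a′,k}(U))⁻¹` — the Hilbert-adjoint gauge-invariant extension of the Hessian in the `Δ₁`-slot (print's `G̃⁻¹ = Δ_π + DRD* + Q*aQ`; its
inverse is the `G` of `HB = GQ*(QGQ*)⁻¹B` (3.126) and the `G₁` of (3.146)–(3.153) ∕ [B11] (103), (110)).  The bare-Hessian operator `B9Eq326OperatorTower.laplaceAk`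
is print's `G₀⁻¹` (p. 421). [cite: Balaban1985BackgroundPropagators, (3.122) p.420, (3.119) p.419, (3.26) p.395, (3.130) p.421; Balaban1985Variational, (110) p.294] -/
def laplaceAkPi (a : ℝ) : BondL2K ℂ d (towerP L m (n + 1)) c₀ W →ₗ[ℂ] BondL2K ℂ d (towerP L m (n + 1)) c₀ W :=
  laplaceALatticeK ((η : ℂ))⁻¹ (adTransportW φ U) (adTransportW φ fun b => (U b)⁻¹)
    (LinearMap.adjoint (piOfUk L m n φ η U (GpOfUk L m n φ η U a' hpos')) ∘ₗ hessOp φ η U τ ∘ₗ piOfUk L m n φ η U (GpOfUk L m n φ η U a' hpos'))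
    (RofUk L m n φ η U) (QkW L m n φ U hL αU hα1 hU1 hreg (c₁ := c₁)) a

/-- **`Δ̃_{a,k}(U)` IS SYMMETRIC** for a unitary background, a `*`-trace and the cell's norming (`π†Δ^ηπ` symmetric by `invariantExtension_isSymmetric` at the
Hermitian Hessian `hessOp_isSymmetric_of_trace`; `R_k` symmetric; transporters mutually adjoint). [cite: Balaban1985BackgroundPropagators, (3.122) p.420, (3.10) p.392] -/
theorem laplaceAkPi_isSymmetric (hU : ∀ b, star (U b : 𝔸) = ((U b)⁻¹ : 𝔸ˣ)) (hτ₁ : ∀ X : 𝔸, τ (star X) = conj (τ X))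
    (hτ₂ : ∀ X Y : 𝔸, τ (X * Y) = τ (Y * X)) (hφ : ∀ X Y : 𝔸, ⟪φ.symm X, φ.symm Y⟫_ℂ = τ (star X * Y)) (a : ℝ) :
    (laplaceAkPi L m n φ τ η U a' hpos' hL αU hα1 hU1 hreg (c₁ := c₁) a).IsSymmetric :=
  laplaceALatticeK_isSymmetric (by rw [map_inv₀, Complex.conj_ofReal]) (adTransportW_adjoint φ τ hτ₂ hU hφ)
    (invariantExtension_isSymmetric _ (hessOp_isSymmetric_of_trace φ τ hτ₁ hτ₂ η hU hφ)) (RofUk_isSymmetric L m n φ η U)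

variable {a : ℝ}
  (hpos : ∀ x : BondL2K ℂ d (towerP L m (n + 1)) c₀ W, x ≠ 0 →
    0 < RCLike.re ⟪x, laplaceAkPi L m n φ τ η U a' hpos' hL αU hα1 hU1 hreg (c₁ := c₁) a x⟫_ℂ)
  (g2 : ∀ l : SiteL2K ℂ d (towerP L m (n + 1)) c₀ W, QprimeTowerW L m n φ U l = 0 →
    QkW L m n φ U hL αU hα1 hU1 hreg (c₀ := c₀) (c₁ := c₁) (covDerivL2K ℂ c₀ ((η : ℂ))⁻¹ (adTransportW φ U) l) = 0)

include g2

/-- **(3.124) `Q_k G̃ D_U R_k = 0` FOR PRINT's OPERATOR**, `G̃ = G1LatticeK hpos` at `Δ̃_{a,k}(U)`: from the ONE displayed letter (g2) = (3.115) for the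
composite averaging; (g1) DISCHARGED by construction (`π_k(U)` kills the gauge modes, `GpOfUk_gaugeMode`). [cite: Balaban1985BackgroundPropagators, (3.124) p.420, (3.115) p.418] -/
theorem laplaceAkPi_gaugeMode_h124 (s : SiteL2K ℂ d (towerP L m (n + 1)) c₀ W) :
    QkW L m n φ U hL αU hα1 hU1 hreg (c₀ := c₀) (c₁ := c₁)
      (G1LatticeK hpos (covDerivL2K ℂ c₀ ((η : ℂ))⁻¹ (adTransportW φ U) (RofUk L m n φ η U s))) = 0 :=
  h124_of_invariantExtension _ _ hpos (fun _ hl => piOfUk_gaugeMode L m n φ η U _ (fun l hl => GpOfUk_gaugeMode L m n φ η U a' hpos' l hl) hl) g2 s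

/-- **p. 425 `R_k D*_U G̃ D_U R_k = R_k` FOR PRINT's OPERATOR**, from (g2) alone. [cite: Balaban1985BackgroundPropagators, p.425, (3.124) p.420] -/
theorem laplaceAkPi_gaugeMode_hRDR (s : SiteL2K ℂ d (towerP L m (n + 1)) c₀ W) :
    RofUk L m n φ η U (covDivL2K ℂ c₀ ((η : ℂ))⁻¹ (adTransportW φ fun b => (U b)⁻¹)
      (G1LatticeK hpos (covDerivL2K ℂ c₀ ((η : ℂ))⁻¹ (adTransportW φ U) (RofUk L m n φ η U s)))) = RofUk L m n φ η U s :=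
  hRDR_of_invariantExtension _ _ hpos (fun _ hl => piOfUk_gaugeMode L m n φ η U _ (fun l hl => GpOfUk_gaugeMode L m n φ η U a' hpos' l hl) hl) g2 s

/-- **(3.124) `R_k D*_U G̃ Q_k† = 0` FOR PRINT's OPERATOR** at a unitary background with a `*`-trace (the symmetric setting: `D*_U = D_U†`, Hessian Hermitian).
[cite: Balaban1985BackgroundPropagators, (3.124) p.420] -/
theorem laplaceAkPi_gaugeMode_h124' (hU : ∀ b, star (U b : 𝔸) = ((U b)⁻¹ : 𝔸ˣ)) (hτ₁ : ∀ X : 𝔸, τ (star X) = conj (τ X))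
    (hτ₂ : ∀ X Y : 𝔸, τ (X * Y) = τ (Y * X)) (hφ : ∀ X Y : 𝔸, ⟪φ.symm X, φ.symm Y⟫_ℂ = τ (star X * Y)) (y : BondL2K ℂ d m c₁ W) :
    RofUk L m n φ η U (covDivL2K ℂ c₀ ((η : ℂ))⁻¹ (adTransportW φ fun b => (U b)⁻¹)
      (G1LatticeK hpos (LinearMap.adjoint (QkW L m n φ U hL αU hα1 hU1 hreg (c₀ := c₀) (c₁ := c₁)) y))) = 0 :=
  h124'_of_invariantExtension _ _ hpos (by rw [map_inv₀, Complex.conj_ofReal]) (adTransportW_adjoint φ τ hτ₂ hU hφ)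
    (hessOp_isSymmetric_of_trace φ τ hτ₁ hτ₂ η hU hφ)
    (fun _ hl => piOfUk_gaugeMode L m n φ η U _ (fun l hl => GpOfUk_gaugeMode L m n φ η U a' hpos' l hl) hl) g2 y

variable (hQ : Function.Surjective (QkW L m n φ U hL αU hα1 hU1 hreg (c₀ := c₀) (c₁ := c₁)))

/-- **PRINT's `Q𝔊 = 0` ([B11] p. 294) FOR THE `k`-TH-STEP `𝔊̃_k(U) := frakGLatticeK hpos hQ` AT `Δ̃_{a,k}(U)`**, modulo (g2) = (3.115) only.
[cite: Balaban1985Variational, (110)–(111) p.294; Balaban1985BackgroundPropagators, (3.153) p.426, (3.124) p.420] -/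
theorem Q_frakGLatticeK_pi (x : BondL2K ℂ d (towerP L m (n + 1)) c₀ W) :
    QkW L m n φ U hL αU hα1 hU1 hreg (c₀ := c₀) (c₁ := c₁) (frakGLatticeK hpos hQ x) = 0 :=
  Q_frakGLatticeK hpos hQ (laplaceAkPi_gaugeMode_h124 L m n φ τ η U a' hpos' hL αU hα1 hU1 hreg hpos g2) x

/-- **PRINT's `RD*𝔊 = 0` ([B11] p. 294) FOR THE `k`-TH-STEP `𝔊̃_k(U)`** at a unitary background with a `*`-trace, modulo (g2) = (3.115) only.
[cite: Balaban1985Variational, (110)–(111) p.294; Balaban1985BackgroundPropagators, (3.153) p.426, (3.124) p.420, p.425] -/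
theorem RDstar_frakGLatticeK_pi (hU : ∀ b, star (U b : 𝔸) = ((U b)⁻¹ : 𝔸ˣ)) (hτ₁ : ∀ X : 𝔸, τ (star X) = conj (τ X))
    (hτ₂ : ∀ X Y : 𝔸, τ (X * Y) = τ (Y * X)) (hφ : ∀ X Y : 𝔸, ⟪φ.symm X, φ.symm Y⟫_ℂ = τ (star X * Y))
    (x : BondL2K ℂ d (towerP L m (n + 1)) c₀ W) :
    RofUk L m n φ η U (covDivL2K ℂ c₀ ((η : ℂ))⁻¹ (adTransportW φ fun b => (U b)⁻¹) (frakGLatticeK hpos hQ x)) = 0 :=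
  RDstar_frakGLatticeK hpos hQ (laplaceAkPi_gaugeMode_h124' L m n φ τ η U a' hpos' hL αU hα1 hU1 hreg hpos g2 hU hτ₁ hτ₂ hφ)
    (laplaceAkPi_gaugeMode_hRDR L m n φ τ η U a' hpos' hL αU hα1 hU1 hreg hpos g2) x

/-! ## §4 The PAIR-TYPED (bilinear) slot: `Δ̃ʰ_{a,k}(U)` with `Δ_{π,k}(U) = π_kᵗΔ^ηπ_k` — holomorphic along complex background families -/

omit g2 in
/-- **PRINT's OPERATOR (3.122) WITH THE BILINEAR EXTENSION IN THE SLOT**: `Δ̃ʰ_{a,k}(U) := laplaceALatticeK η⁻¹ R(U) R(U⁻¹) (Δ_{π,k}(U)) R_k(U) Q_k(U) a`,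
`Δ_{π,k}(U) = deltaPiOfUk … (GpOfUk …)` (§2, the bilinear transpose — it stays inside the chain's PAIR typing `(R(U), R(U⁻¹))`, no variable conjugated, hence
is the slot to use for rows whose complex variable is the BACKGROUND (t4-ne9-idea-1 g99 J-Δπ-hol, l.51215); at a unitary background it agrees with §3's
adjoint slot — the k-level reality lemma is NOT ported here). [cite: Balaban1985BackgroundPropagators, (3.122) p.420, (3.119) p.419] -/
def laplaceAkPiHol (a : ℝ) : BondL2K ℂ d (towerP L m (n + 1)) c₀ W →ₗ[ℂ] BondL2K ℂ d (towerP L m (n + 1)) c₀ W :=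
  laplaceALatticeK ((η : ℂ))⁻¹ (adTransportW φ U) (adTransportW φ fun b => (U b)⁻¹)
    (deltaPiOfUk L m n φ τ η U (GpOfUk L m n φ η U a' hpos')) (RofUk L m n φ η U) (QkW L m n φ U hL αU hα1 hU1 hreg (c₁ := c₁)) a

variable (hposH : ∀ x : BondL2K ℂ d (towerP L m (n + 1)) c₀ W, x ≠ 0 →
    0 < RCLike.re ⟪x, laplaceAkPiHol L m n φ τ η U a' hpos' hL αU hα1 hU1 hreg (c₁ := c₁) a x⟫_ℂ)

/-- **(3.124) `Q_k G̃ʰ D_U R_k = 0` FOR THE PAIR-TYPED OPERATOR**, from (g2) = (3.115) alone ((g1) = `deltaPiOfUk_GpOfUk_gaugeMode`; `B9Eq3124GaugeModes.h124_RLatticeK`).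
[cite: Balaban1985BackgroundPropagators, (3.124) p.420, (3.115) p.418] -/
theorem laplaceAkPiHol_gaugeMode_h124 (s : SiteL2K ℂ d (towerP L m (n + 1)) c₀ W) :
    QkW L m n φ U hL αU hα1 hU1 hreg (c₀ := c₀) (c₁ := c₁)
      (G1LatticeK hposH (covDerivL2K ℂ c₀ ((η : ℂ))⁻¹ (adTransportW φ U) (RofUk L m n φ η U s))) = 0 :=
  B9Eq3124GaugeModes.h124_RLatticeK hposH (fun _ hl => deltaPiOfUk_GpOfUk_gaugeMode L m n φ τ η U a' hpos' hl) g2 s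

/-- **p. 425 `R_k D*_U G̃ʰ D_U R_k = R_k` FOR THE PAIR-TYPED OPERATOR**, from (g2) alone. [cite: Balaban1985BackgroundPropagators, p.425] -/
theorem laplaceAkPiHol_gaugeMode_hRDR (s : SiteL2K ℂ d (towerP L m (n + 1)) c₀ W) :
    RofUk L m n φ η U (covDivL2K ℂ c₀ ((η : ℂ))⁻¹ (adTransportW φ fun b => (U b)⁻¹)
      (G1LatticeK hposH (covDerivL2K ℂ c₀ ((η : ℂ))⁻¹ (adTransportW φ U) (RofUk L m n φ η U s)))) = RofUk L m n φ η U s :=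
  B9Eq3124GaugeModes.hRDR_RLatticeK hposH (fun _ hl => deltaPiOfUk_GpOfUk_gaugeMode L m n φ τ η U a' hpos' hl) g2 s

variable (hQH : Function.Surjective (QkW L m n φ U hL αU hα1 hU1 hreg (c₀ := c₀) (c₁ := c₁)))

/-- **PRINT's `Q𝔊 = 0` FOR THE PAIR-TYPED `𝔊̃ʰ_k(U) := frakGLatticeK hposH hQ`**, modulo (g2) = (3.115) only (no symmetry needed).
[cite: Balaban1985Variational, (110)–(111) p.294; Balaban1985BackgroundPropagators, (3.124) p.420] -/
theorem Q_frakGLatticeK_piHol (x : BondL2K ℂ d (towerP L m (n + 1)) c₀ W) :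
    QkW L m n φ U hL αU hα1 hU1 hreg (c₀ := c₀) (c₁ := c₁) (frakGLatticeK hposH hQH x) = 0 :=
  Q_frakGLatticeK hposH hQH (laplaceAkPiHol_gaugeMode_h124 L m n φ τ η U a' hpos' hL αU hα1 hU1 hreg g2 hposH) x

end Literature.MathematicalPhysics.QuantumFieldTheory.Balaban1983to89.B9Eq3119DeltaPiTower

end
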